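import Summits.FinalStateConjecture.FinalStateConjecture.Theorems.SwallowTheDatumKerrShieldedSettlesStubCollarCauchyAux
import Mathlib.Analysis.Calculus.Deriv.MeanValue
import Mathlib.Analysis.Calculus.Deriv.Inv
import Mathlib.Analysis.SpecialFunctions.Sqrt
import HarnessLib

/-!
# Route EIHFluxBalance — `ModulatedKerrHandoff`, line `swallow-transfer`, stub T2 `stub_bentLabChart`,
# part 1: the fibre maps `s ↦ s + χ₁(ρ/s − 1)·T(ρ)` of the bent lab chart

Helper file for the crux `stmt-FinalStateConjecture-10167`
(`Summit.FinalStateConjecture.FinalStateConjecture.Theses.EIHFluxBalance.ModulatedKerrHandoff`), line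
`swallow-transfer`, registered stub `stub_bentLabChart` (T2). The bent lab chart of the line is the lab-time
dependent Kerr–Schild time translation `f(x) = x + Θ(x) e₀`, `Θ(x) = φ(x⁰, |x̲|)` with the FIBRE SHIFT
`φ(s, ρ) = χ₁(ρ/s − 1) · T(ρ)` (`χ₁ = Real.smoothTransition`, `T = bentHeight M a` the hard-coded leaf height of
route SwallowTheDatum, `|x̲| = E4.spatialNorm x`). This part is the one-variable real analysis of `T` and `φ`
(no definitions; `φ` is always written out):

* `monotone_bentHeight` (`T′ = bentSlope ≥ 0`; `T ≥ 0` is the tree's `CollarCauchy.bentHeight_nonneg`), and the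
  square-root form of the logarithmic growth of the leaf, `bentHeight_le_sqrt : T(ρ) ≤ 4M√(ρ/M) − 4M` (`ρ ≥ M`;
  from `bentHeight_le_two_mul_log` and `log u ≤ 2√u − 2`), whence `bentHeight_two_mul_lt : T(2t) < t` for
  `t ≥ 32M` (every late lab slab lies above the data leaf);
* `φ ≥ 0`, `φ ≤ T`, `φ(s, ρ) = 0` for `ρ ≤ s` (the chart is the identity on the solid cone `|x̲| ≤ x⁰`) and
  `φ(s, ρ) = T(ρ)` for `ρ ≥ 2s` (full leaf translation far out), `s > 0`;
* `hasDerivAt_fibreShift : ∂_s φ = χ₁′(ρ/s − 1)·(−ρ/s²)·T(ρ)` and the decisive smallness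
  `abs_fibreDeriv_le_half : |∂_s φ(s, ρ)| ≤ 1/2` for `s ≥ 2048 M` and all `ρ` (`χ₁′` lives on `s < ρ < 2s`,
  `|χ₁′| ≤ 2` by the tree's `deriv_smoothTransition_le_two`, `T(ρ) ≤ T(2s) ≤ 4M√(2s/M)`, so
  `|∂_s φ| ≤ 32/√(2s/M)`);
* consequences for the fibre maps `s ↦ s + φ(s, ρ)`: continuity off `s = 0`, STRICT MONOTONICITY on
  `[2048 M, ∞)` (`strictMonoOn_fibreMap`), and the intermediate-value lemma `exists_fibreMap_eq`.

Part 2 (`…BentLabChartAux2`) does the `E4` geometry; the stub itself is `…BentLabChart`.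
References: Dafermos–Rodnianski arXiv:0811.0354, §5.1 (ingoing Kerr–Schild chart, the leaf height);
elementary calculus otherwise.
-/

-- the summit and the problem share the name `FinalStateConjecture`, so every namespace here repeats it
set_option linter.dupNamespace false

noncomputable section

open Set Filter Topology
open Literature.Geometry.Lorentzian
open Literature.Analysis.Calculus (differentiable_smoothTransition deriv_smoothTransition_of_nonpos
  deriv_smoothTransition_of_one_le)
open Literature.NumberTheory.Sieve.GreenTao2008 (deriv_smoothTransition_nonneg deriv_smoothTransition_le_two)
open Summit.FinalStateConjecture.FinalStateConjecture.Theorems.KerrShieldedDataExist.Negative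
  (bentHeight mass_pos hasDerivAt_bentHeight deriv_bentHeight bentSlope_nonneg)
open Summit.FinalStateConjecture.FinalStateConjecture.Theorems.KerrShieldedSettles.Negative
  (bentHeight_le_two_mul_log)
open Summit.FinalStateConjecture.FinalStateConjecture.Theorems.SwallowTheDatum.KerrShieldedSettles.CollarCauchy
  (bentHeight_nonneg)

namespace Summit.FinalStateConjecture.FinalStateConjecture.Cruxes.ModulatedKerrHandoff.SwallowTransfer

variable {M a : ℝ}

/-! ## The bent height is monotone and of logarithmic growth -/

/-- `T = bentHeight M a` is monotone on `ℝ` (`T′ = bentSlope ≥ 0`, `deriv_bentHeight`, `bentSlope_nonneg`).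
[folklore] -/
theorem monotone_bentHeight (h : |a| < M) : Monotone (bentHeight M a) :=
  monotone_of_deriv_nonneg (fun r ↦ (hasDerivAt_bentHeight h r).differentiableAt) fun r ↦ by
    rw [deriv_bentHeight h]; exact bentSlope_nonneg h r

/-- `k ≤ √(ρ/M)` as soon as `k² M ≤ ρ` (`k ≥ 0`, `M > 0`). [folklore] -/
theorem le_sqrt_div (hM : 0 < M) {k ρ : ℝ} (hk : 0 ≤ k) (hρ : k ^ 2 * M ≤ ρ) :
    k ≤ Real.sqrt (ρ / M) := by
  rw [Real.le_sqrt hk (div_nonneg ((mul_nonneg (sq_nonneg k) hM.le).trans hρ) hM.le), le_div_iff₀ hM]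
  exact hρ

/-- **Logarithmic growth of the leaf height, square-root form**: `T(ρ) ≤ 4M √(ρ/M) − 4M` for `ρ ≥ M`
(`T(ρ) ≤ 2M log(ρ/M)`, `bentHeight_le_two_mul_log`, and `log u ≤ 2√u − 2`). [folklore] -/
theorem bentHeight_le_sqrt (h : |a| < M) {ρ : ℝ} (hρ : M ≤ ρ) :
    bentHeight M a ρ ≤ 4 * M * Real.sqrt (ρ / M) - 4 * M := by
  have hM := mass_pos h
  have h1 := bentHeight_le_two_mul_log h hρ
  have hu : 0 < ρ / M := div_pos (hM.trans_le hρ) hM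
  have h2 := Real.log_le_sub_one_of_pos (Real.sqrt_pos.2 hu)
  rw [Real.log_sqrt hu.le] at h2
  have h3 := mul_le_mul_of_nonneg_left h2 (show (0 : ℝ) ≤ 4 * M by linarith)
  linarith

/-- **Every late slab lies above the leaf, quantitatively**: `T(2t) < t` for `t ≥ 32M`. [folklore] -/
theorem bentHeight_two_mul_lt (h : |a| < M) {t : ℝ} (ht : 32 * M ≤ t) : bentHeight M a (2 * t) < t := by
  have hM := mass_pos h
  have ht0 : 0 < t := by linarith
  have h1 := bentHeight_le_sqrt h (ρ := 2 * t) (by linarith)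
  set X := Real.sqrt (2 * t / M) with hX
  have hX8 : 8 ≤ X := le_sqrt_div hM (by norm_num) (by linarith)
  have hX2 : X ^ 2 = 2 * t / M := Real.sq_sqrt (by positivity)
  have ht' : 2 * t = M * X ^ 2 := by rw [hX2]; field_simp
  nlinarith [mul_nonneg (mul_nonneg hM.le (by linarith : (0 : ℝ) ≤ X)) (sub_nonneg.2 hX8)]

/-! ## The fibre shift `φ(s, ρ) = χ₁(ρ/s − 1) · T(ρ)` -/

/-- `φ(s, ρ) ≥ 0`. [folklore] -/
theorem fibreShift_nonneg (h : |a| < M) (s ρ : ℝ) :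
    0 ≤ Real.smoothTransition (ρ / s - 1) * bentHeight M a ρ :=
  mul_nonneg (Real.smoothTransition.nonneg _) (bentHeight_nonneg h ρ)

/-- `φ(s, ρ) ≤ T(ρ)`. [folklore] -/
theorem fibreShift_le (h : |a| < M) (s ρ : ℝ) :
    Real.smoothTransition (ρ / s - 1) * bentHeight M a ρ ≤ bentHeight M a ρ :=
  mul_le_of_le_one_left (bentHeight_nonneg h ρ) (Real.smoothTransition.le_one _)

/-- `φ(s, ρ) = 0` for `ρ ≤ s`, `s > 0`: on the solid cone `{|x̲| ≤ x⁰}` the bent lab chart is the identity.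
[folklore] -/
theorem fibreShift_eq_zero_of_le {s ρ : ℝ} (hs : 0 < s) (hρ : ρ ≤ s) :
    Real.smoothTransition (ρ / s - 1) * bentHeight M a ρ = 0 := by
  have : ρ / s - 1 ≤ 0 := by rw [sub_nonpos, div_le_one hs]; exact hρ
  rw [Real.smoothTransition.zero_of_nonpos this, zero_mul]

/-- `φ(s, ρ) = T(ρ)` for `2s ≤ ρ`, `s > 0`: beyond `{|x̲| ≥ 2x⁰}` the chart is the full leaf translation.
[folklore] -/
theorem fibreShift_eq_of_two_mul_le {s ρ : ℝ} (hs : 0 < s) (hρ : 2 * s ≤ ρ) :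
    Real.smoothTransition (ρ / s - 1) * bentHeight M a ρ = bentHeight M a ρ := by
  have : 1 ≤ ρ / s - 1 := by rw [le_sub_iff_add_le, le_div_iff₀ hs]; linarith
  rw [Real.smoothTransition.one_of_one_le this, one_mul]

/-- `∂_s φ(s, ρ) = χ₁′(ρ/s − 1) · (−ρ/s²) · T(ρ)` for `s ≠ 0` (chain rule). [folklore] -/
theorem hasDerivAt_fibreShift (M a ρ : ℝ) {s : ℝ} (hs : s ≠ 0) :
    HasDerivAt (fun s : ℝ ↦ Real.smoothTransition (ρ / s - 1) * bentHeight M a ρ)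
      (deriv Real.smoothTransition (ρ / s - 1) * (-ρ / s ^ 2) * bentHeight M a ρ) s := by
  have h1 : HasDerivAt (fun s : ℝ ↦ ρ / s - 1) (-ρ / s ^ 2) s := by
    have h := ((hasDerivAt_inv hs).const_mul ρ).sub_const 1
    have e1 : (fun s : ℝ ↦ ρ / s - 1) = fun y ↦ ρ * y⁻¹ - 1 := by
      funext y; rw [div_eq_mul_inv]
    have e2 : -ρ / s ^ 2 = ρ * -(s ^ 2)⁻¹ := by ring
    rw [e1, e2]
    exact h
  exact ((differentiable_smoothTransition _).hasDerivAt.comp s h1).mul_const (bentHeight M a ρ)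

/-- **`|∂_s φ| ≤ 1/2` beyond the late time `2048 M`** (all `ρ`): `χ₁′` vanishes unless `s < ρ < 2s`, and
there `|χ₁′| ≤ 2`, `ρ/s² < 2/s`, `T(ρ) ≤ T(2s) ≤ 4M√(2s/M)`, so `|∂_s φ| ≤ 32/√(2s/M) ≤ 1/2`. [folklore] -/
theorem abs_fibreDeriv_le_half (h : |a| < M) {s : ℝ} (hs : 2048 * M ≤ s) (ρ : ℝ) :
    |deriv Real.smoothTransition (ρ / s - 1) * (-ρ / s ^ 2) * bentHeight M a ρ| ≤ 1 / 2 := by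
  have hM := mass_pos h
  have hs0 : 0 < s := by linarith
  by_cases hzone : s < ρ ∧ ρ < 2 * s
  · obtain ⟨h1, h2⟩ := hzone
    have hρ0 : 0 ≤ ρ := by linarith
    have hA : |deriv Real.smoothTransition (ρ / s - 1)| ≤ 2 := by
      rw [abs_of_nonneg (deriv_smoothTransition_nonneg _)]
      exact deriv_smoothTransition_le_two _
    have hB : |(-ρ / s ^ 2)| ≤ 2 / s := by
      rw [abs_div, abs_neg, abs_of_nonneg hρ0, abs_of_pos (by positivity : (0 : ℝ) < s ^ 2),
        div_le_div_iff₀ (by positivity) hs0]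
      nlinarith
    have hC : |bentHeight M a ρ| ≤ 4 * M * Real.sqrt (2 * s / M) - 4 * M := by
      rw [abs_of_nonneg (bentHeight_nonneg h ρ)]
      exact (monotone_bentHeight h h2.le).trans (bentHeight_le_sqrt h (by linarith))
    set X := Real.sqrt (2 * s / M) with hX
    have hX64 : 64 ≤ X := le_sqrt_div hM (by norm_num) (by linarith)
    have hX2 : X ^ 2 = 2 * s / M := Real.sq_sqrt (by positivity)
    have hs' : 2 * s = M * X ^ 2 := by rw [hX2]; field_simp
    have hAB : |deriv Real.smoothTransition (ρ / s - 1)| * |(-ρ / s ^ 2)| ≤ 2 * (2 / s) :=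
      mul_le_mul hA hB (abs_nonneg _) (by norm_num)
    have hC' : |bentHeight M a ρ| ≤ 4 * M * X := by linarith
    rw [abs_mul, abs_mul]
    calc |deriv Real.smoothTransition (ρ / s - 1)| * |(-ρ / s ^ 2)| * |bentHeight M a ρ|
        ≤ 2 * (2 / s) * (4 * M * X) := mul_le_mul hAB hC' (abs_nonneg _) (by positivity)
      _ = 16 * M * X / s := by ring
      _ ≤ 1 / 2 := by
          rw [div_le_div_iff₀ hs0 (by norm_num : (0 : ℝ) < 2)]
          nlinarith [mul_nonneg (mul_nonneg hM.le (by linarith : (0 : ℝ) ≤ X)) (sub_nonneg.2 hX64)]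
  · have h0 : deriv Real.smoothTransition (ρ / s - 1) = 0 := by
      rcases not_and_or.1 hzone with h1 | h1
      · refine deriv_smoothTransition_of_nonpos ?_
        rw [sub_nonpos, div_le_one hs0]
        exact not_lt.1 h1
      · refine deriv_smoothTransition_of_one_le ?_
        rw [le_sub_iff_add_le, le_div_iff₀ hs0]
        linarith [not_lt.1 h1]
    rw [h0, zero_mul, zero_mul, abs_zero]
    norm_num

/-! ## The fibre maps `s ↦ s + φ(s, ρ)` -/

/-- The fibre map is continuous at every `s ≠ 0`. [folklore] -/
theorem continuousAt_fibreMap (M a ρ : ℝ) {s : ℝ} (hs : s ≠ 0) :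
    ContinuousAt (fun s : ℝ ↦ s + Real.smoothTransition (ρ / s - 1) * bentHeight M a ρ) s :=
  ((hasDerivAt_id' s).fun_add (hasDerivAt_fibreShift M a ρ hs)).continuousAt

/-- **The fibre maps are strictly increasing on `[2048 M, ∞)`** (derivative `1 + ∂_s φ ≥ 1/2`).
[folklore] -/
theorem strictMonoOn_fibreMap (h : |a| < M) (ρ : ℝ) :
    StrictMonoOn (fun s : ℝ ↦ s + Real.smoothTransition (ρ / s - 1) * bentHeight M a ρ)
      (Ici (2048 * M)) := by
  have hM := mass_pos h
  refine strictMonoOn_of_hasDerivWithinAt_pos (convex_Ici _) (fun s hs ↦ ?_)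
    (f' := fun s ↦ 1 + deriv Real.smoothTransition (ρ / s - 1) * (-ρ / s ^ 2) * bentHeight M a ρ)
    (fun s hs ↦ ?_) (fun s hs ↦ ?_)
  · have hs0 : (0 : ℝ) < s := lt_of_lt_of_le (by positivity) (show 2048 * M ≤ s from hs)
    exact (continuousAt_fibreMap M a ρ hs0.ne').continuousWithinAt
  · rw [interior_Ici] at hs
    have hs0 : (0 : ℝ) < s := lt_trans (by positivity) (show 2048 * M < s from hs)
    exact ((hasDerivAt_id' s).fun_add (hasDerivAt_fibreShift M a ρ hs0.ne')).hasDerivWithinAt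
  · rw [interior_Ici] at hs
    have h1 := abs_fibreDeriv_le_half h (le_of_lt hs) ρ
    have h2 := neg_abs_le (deriv Real.smoothTransition (ρ / s - 1) * (-ρ / s ^ 2) * bentHeight M a ρ)
    show (0 : ℝ) < 1 + _
    linarith

/-- **Intermediate values on the fibres**: if `t₁ > 0` and `t₁ + φ(t₁, ρ) < Y` then `s + φ(s, ρ) = Y` for
some `s > t₁` (continuity on `[t₁, Y]`, and `Y ≤ Y + φ(Y, ρ)`). [folklore] -/
theorem exists_fibreMap_eq (h : |a| < M) {t₁ : ℝ} (ht₁ : 0 < t₁) (ρ Y : ℝ)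
    (hY : t₁ + Real.smoothTransition (ρ / t₁ - 1) * bentHeight M a ρ < Y) :
    ∃ s : ℝ, t₁ < s ∧ s + Real.smoothTransition (ρ / s - 1) * bentHeight M a ρ = Y := by
  have hY' : t₁ ≤ Y := by linarith [fibreShift_nonneg h t₁ ρ]
  have hcont : ContinuousOn (fun s : ℝ ↦ s + Real.smoothTransition (ρ / s - 1) * bentHeight M a ρ)
      (Icc t₁ Y) := fun s hs ↦
    (continuousAt_fibreMap M a ρ (ht₁.trans_le hs.1).ne').continuousWithinAt
  have hmem : Y ∈ Icc (t₁ + Real.smoothTransition (ρ / t₁ - 1) * bentHeight M a ρ)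
      (Y + Real.smoothTransition (ρ / Y - 1) * bentHeight M a ρ) :=
    ⟨hY.le, le_add_of_nonneg_right (fibreShift_nonneg h Y ρ)⟩
  obtain ⟨s, hs, hsY⟩ := intermediate_value_Icc hY' hcont hmem
  refine ⟨s, lt_of_le_of_ne hs.1 ?_, hsY⟩
  rintro rfl
  exact hY.ne hsY

/-- **Anchor of part 1** (registered sub-goal `bentLab_fibreMap_strictMonoOn` of the crux item, serving stub
`stub_bentLabChart`): after the late time `2048 M` every fibre map `s ↦ s + χ₁(ρ/s − 1)·T(ρ)` of the bent lab
chart is strictly increasing (`strictMonoOn_fibreMap`). [folklore] -/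
theorem bentLab_fibreMap_strictMonoOn : open Summit.FinalStateConjecture.FinalStateConjecture.Theorems.KerrShieldedDataExist.Negative in ∀ (M a : ℝ), |a| < M → ∀ ρ : ℝ, StrictMonoOn (fun s : ℝ ↦ s + Real.smoothTransition (ρ / s - 1) * bentHeight M a ρ) (Set.Ici (2048 * M)) :=
  fun _ _ h ρ ↦ strictMonoOn_fibreMap h ρ

end Summit.FinalStateConjecture.FinalStateConjecture.Cruxes.ModulatedKerrHandoff.SwallowTransfer

end
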